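import Summits.CriticalPhenomena.Ising3D.BlockTaylorGermFamilies
import Mathlib.Tactic.Linarith
import Mathlib.Tactic.Positivity
import Mathlib.Tactic.Ring
import HarnessLib

/-!
# A derivative functional acts TERMWISE on the Hogervorst–Rychkov `z`-series of an even-sector block
(cell `pub-ising3x`, seat boot-1; gate (g0′′) of the M3-γ milestone: the derivative-functional analogue
of `BlockZSeries.hasSum_pointFunctional_crossF_hrZ`)

HONEST FRAMING: lottery ticket; floor = tightest certified 3D Ising CFT bounds; no exact-solution
claim without a proof.

For a Taylor (derivative) functional `φ` at a diagonal point `(x,x)` and a genuine `ℤ₂`-even block `g`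
at ANY admissible `(Δ, ℓ)` (regular, conserved current or accidental degeneracy),
`φ[F^s_σ[g]] = Σ_{(n,j)} (A_{n,j}/λ_ℓ) φ[F^s_σ[𝒫_{Δ+n,j}]]` (`IsTaylorFunctional.hasSum_crossF_hrZTerm`):
so a γ-certificate verifies block positivity exactly like the point-functional certificates of pub-ising3d —
finitely many head terms by interval arithmetic, the tail by a region inequality on the closed-form
`φ[F[𝒫_{E,j}]]` (gate (g2)). Proof: each `𝒫_{E,j} = (z z̄)^{(E-j)/2} 𝒫_j` has block shape with the
FINITE non-negative array `zLegendreArr j` of `𝒫_j`, so `crossF_germ_majorant` bounds the germ majorant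
of `F[𝒫_{E,j}]` by `C₁ 𝒫_{E,j}(X₁,X₁) + |σ| C₂ 𝒫_{E,j}(X₂,X₂)`; summing against `A_{n,j}/λ_ℓ ≥ 0` gives
the block VALUES `g(X_t,X_t)` (`IsAdmissible3D.hasSum_hrZTerm_hrBlock`), so the M-test
(`IsTaylorFunctional.hasSum_mul_of_hasSummableGerms`) applies.
Sources: Hogervorst–Rychkov 2013 §3 eqs. (3.4)–(3.9) as typed in `BlockZSeries`/`BlockUniquenessLimit`.
-/

namespace Summit.CriticalPhenomena.Ising3D

open Finset Set
open Literature.MathematicalPhysics.QuantumFieldTheory.ConformalBootstrap3D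

/-- The finitely supported, non-negative coefficient array of `𝒫_j(x,y) = Σ_{i+r=j} λ_i λ_r x^i y^r`.
[cite: HogervorstRychkov2013, §3 eq. (3.6)] -/
noncomputable def zLegendreArr (j : ℕ) (p : ℕ × ℕ) : ℝ :=
  if p.1 + p.2 = j then legendreLam p.1 * legendreLam p.2 else 0

/-- `zLegendreArr j ≥ 0`. [folklore] -/
theorem zLegendreArr_nonneg (j : ℕ) (p : ℕ × ℕ) : 0 ≤ zLegendreArr j p := by
  unfold zLegendreArr
  split_ifs
  · exact mul_nonneg (legendreLam_pos _).le (legendreLam_pos _).le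
  · exact le_rfl

/-- Off the antidiagonal `j` the array vanishes. [folklore] -/
theorem zLegendreArr_eq_zero {j : ℕ} {p : ℕ × ℕ} (hp : p ∉ antidiagonal j) : zLegendreArr j p = 0 := by
  unfold zLegendreArr
  rw [if_neg (fun h => hp (mem_antidiagonal.mpr h))]

/-- `𝒫_j` is the (finite) double power series with array `zLegendreArr j`, on the whole bidisk.
[cite: HogervorstRychkov2013, §3 eq. (3.6)] -/
theorem isDoublePowerSeriesOn_zLegendreArr (j : ℕ) :
    IsDoublePowerSeriesOn (zLegendreArr j) (zLegendre j) := by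
  intro z zb _ _
  refine ⟨summable_of_ne_finset_zero (s := antidiagonal j) fun p hp => by
    rw [zLegendreArr_eq_zero hp, abs_zero, zero_mul, zero_mul], ?_⟩
  rw [tsum_eq_sum (s := antidiagonal j) fun p hp => by
    rw [zLegendreArr_eq_zero hp, zero_mul, zero_mul]]
  unfold zLegendre
  refine Finset.sum_congr rfl fun p hp => ?_
  rw [zLegendreArr, if_pos (mem_antidiagonal.mp hp)]

/-- The value identity for the term: `X^τ X^τ Σ|zLegendreArr| X^{m+n} = 𝒫_{E,j}(X,X)`, `τ = (E-j)/2`.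
[folklore] -/
theorem zMono_value_eq (E : ℝ) (j : ℕ) {X : ℝ} (hX0 : 0 < X) (hX1 : X < 1) :
    X ^ ((E - (j : ℝ)) / 2) * X ^ ((E - (j : ℝ)) / 2) *
      ∑' p : ℕ × ℕ, |zLegendreArr j p| * X ^ p.1 * X ^ p.2 = zMono E j X X := by
  rw [rpow_mul_tsum_abs_eq (isDoublePowerSeriesOn_zLegendreArr j) (zLegendreArr_nonneg j) _ hX0 hX1]
  rfl

/-- **Termwise action of a derivative functional on the `z`-series of an even-sector block.** For `φ`
Taylor at `(x,x)` (`0 < x < 1`), any `s, σ`, and a genuine block `g` at an admissible `(Δ, ℓ)`: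
`Σ_{(n,j)} (A_{n,j}(Δ,ℓ)/λ_ℓ) · φ[crossF s σ 𝒫_{Δ+n,j}] = φ[crossF s σ g]` (`HasSum`).
[cite: HogervorstRychkov2013, §3 eqs. (3.4), (3.9)] -/
theorem IsTaylorFunctional.hasSum_crossF_hrZTerm {x : ℝ} (hx0 : 0 < x) (hx1 : x < 1)
    {φ : (ℝ → ℝ → ℝ) →ₗ[ℝ] ℝ} (hφ : IsTaylorFunctional x x φ) (s σ : ℝ) {Δ : ℝ} {ℓ : ℕ}
    {g : ℝ → ℝ → ℝ} (hadm : IsAdmissible3D Δ ℓ) (hg : IsConformalBlock3D 0 0 Δ ℓ g) :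
    HasSum (fun q : ℕ × ℕ => hrCoeff Δ ℓ q.1 q.2 / legendreLam ℓ *
        φ (crossF s σ (zMono (Δ + (q.1 : ℝ)) q.2))) (φ (crossF s σ g)) := by
  -- majorant radius and the two shifted points
  have hr : 0 < x * (1 - x) := mul_pos hx0 (by linarith)
  set ρ := x * (1 - x) / 2 with hρdef
  have hρ0 : 0 < ρ := by rw [hρdef]; linarith
  have hρ : ρ < x * (1 - x) := by rw [hρdef]; linarith
  have hX₁ := bgX₁_pos_lt hx0 hρ
  have hX₂ := bgX₂_pos_lt hx1 hρ
  have hℓΔ : (ℓ : ℝ) ≤ Δ := (natCast_le_unitarityBound3D ℓ).trans hadm.1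
  -- the modified family (zero outside the descendant range `j ≤ ℓ + n`)
  set c : ℕ × ℕ → ℝ := fun q => hrCoeff Δ ℓ q.1 q.2 / legendreLam ℓ with hc
  set F : ℕ × ℕ → ℝ → ℝ → ℝ := fun q =>
    if q.2 ≤ ℓ + q.1 then crossF s σ (zMono (Δ + (q.1 : ℝ)) q.2) else 0 with hF
  have hc0 : ∀ q : ℕ × ℕ, 0 ≤ c q := fun q =>
    div_nonneg (hadm.hrCoeff_nonneg _ _) (legendreLam_pos ℓ).le
  have hcz : ∀ q : ℕ × ℕ, ¬ q.2 ≤ ℓ + q.1 → c q = 0 := fun q hq => by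
    simp only [hc]
    rw [hrCoeff_eq_zero_of_lt Δ (by omega), zero_div]
  -- Step 1: summable germs for the modified family
  have hG : HasSummableGerms c F x x ρ := by
    have hex : ∀ q : ℕ × ℕ, ∃ (T : ℕ × ℕ → ℝ) (N : ℝ), HasTaylorGerm (F q) x x (x * (1 - x)) T ∧
        HasSum (fun p : ℕ × ℕ => |T p| * ρ ^ p.1 * ρ ^ p.2) N ∧
        N ≤ bgC₁ s x ρ * zMono (Δ + (q.1 : ℝ)) q.2 (bgX₁ x ρ) (bgX₁ x ρ) +
          |σ| * (bgC₂ s x ρ * zMono (Δ + (q.1 : ℝ)) q.2 (bgX₂ x ρ) (bgX₂ x ρ)) := by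
      intro q
      by_cases hq : q.2 ≤ ℓ + q.1
      · have hτ : 0 ≤ (Δ + (q.1 : ℝ) - (q.2 : ℝ)) / 2 := by
          have : (q.2 : ℝ) ≤ ℓ + q.1 := by exact_mod_cast hq
          linarith
        obtain ⟨T, N, hT, hN, hle⟩ := crossF_germ_majorant (isDoublePowerSeriesOn_zLegendreArr q.2) hτ
          hx0 hx1 (g := zMono (Δ + (q.1 : ℝ)) q.2) (fun z zb _ _ => rfl) s σ hρ0 hρ
        refine ⟨T, N, ?_, hN, ?_⟩
        · simp only [hF, if_pos hq]; exact hT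
        · rw [zMono_value_eq _ _ hX₁.1 hX₁.2, zMono_value_eq _ _ hX₂.1 hX₂.2] at hle
          exact hle
      · refine ⟨0, 0, ?_, ?_, ?_⟩
        · simp only [hF, if_neg hq]; exact hasTaylorGerm_zero x x hr
        · simp
        · have h1 := zMono_nonneg (Δ + (q.1 : ℝ)) q.2 hX₁.1.le hX₁.1.le
          have h2 := zMono_nonneg (Δ + (q.1 : ℝ)) q.2 hX₂.1.le hX₂.1.le
          have : 0 ≤ bgC₁ s x ρ := sq_nonneg _
          have : 0 ≤ bgC₂ s x ρ := sq_nonneg _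
          positivity
    choose T N hT hN hle using hex
    refine ⟨x * (1 - x), T, N, hρ.le, hT, hN, ?_⟩
    -- `|c q| N q ≤ C₁ · hrZTerm(X₁) q + |σ| C₂ · hrZTerm(X₂) q`, both summable (block values)
    have hZ₁ := (hadm.hasSum_hrZTerm_hrBlock (x := bgX₁ x ρ) (y := bgX₁ x ρ) ⟨hX₁.1, hX₁.2⟩
      ⟨hX₁.1, hX₁.2⟩).summable
    have hZ₂ := (hadm.hasSum_hrZTerm_hrBlock (x := bgX₂ x ρ) (y := bgX₂ x ρ) ⟨hX₂.1, hX₂.2⟩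
      ⟨hX₂.1, hX₂.2⟩).summable
    refine ((hZ₁.mul_left (bgC₁ s x ρ)).add (hZ₂.mul_left (|σ| * bgC₂ s x ρ))).of_nonneg_of_le
      (fun q => mul_nonneg (abs_nonneg _) ((hN q).nonneg fun p => by positivity)) fun q => ?_
    rw [abs_of_nonneg (hc0 q)]
    calc c q * N q ≤ c q * (bgC₁ s x ρ * zMono (Δ + (q.1 : ℝ)) q.2 (bgX₁ x ρ) (bgX₁ x ρ) +
          |σ| * (bgC₂ s x ρ * zMono (Δ + (q.1 : ℝ)) q.2 (bgX₂ x ρ) (bgX₂ x ρ))) :=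
          mul_le_mul_of_nonneg_left (hle q) (hc0 q)
      _ = bgC₁ s x ρ * hrZTerm Δ ℓ (bgX₁ x ρ) (bgX₁ x ρ) q +
          |σ| * bgC₂ s x ρ * hrZTerm Δ ℓ (bgX₂ x ρ) (bgX₂ x ρ) q := by
          simp only [hrZTerm, hc]; ring
  -- Step 2: the pointwise identity on the square (A2 + T1: the `z`-series of `g`, pushed through `crossF`)
  have hS : ∀ h k : ℝ, |h| < ρ → |k| < ρ →
      HasSum (fun q => c q * F q (x + h) (x + k)) (crossF s σ g (x + h) (x + k)) := by
    intro h k hh hk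
    have hz := mem_Ioo_of_abs_lt (hh.trans hρ)
    have hzb := mem_Ioo_of_abs_lt (hk.trans hρ)
    have hpt : ∀ z zb : ℝ, z ∈ Ioo (0 : ℝ) 1 → zb ∈ Ioo (0 : ℝ) 1 →
        HasSum (fun q : ℕ × ℕ => (fun x' y' => hrZTerm Δ ℓ x' y' q) z zb) (g z zb) :=
      fun z zb hz hzb => hg.hasSum_hrZTerm_of_isAdmissible hadm hz hzb
    have h1 := hasSum_crossF s σ hpt hz hzb
    refine h1.congr_fun fun q => ?_
    by_cases hq : q.2 ≤ ℓ + q.1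
    · simp only [hF, if_pos hq, crossF, hrZTerm, hc]
      ring
    · simp only [hF, if_neg hq, hcz q hq, crossF, hrZTerm, Pi.zero_apply]
      rw [show hrCoeff Δ ℓ q.1 q.2 = 0 from hrCoeff_eq_zero_of_lt Δ (by omega)]
      ring
  -- Step 3: the M-test, then undo the modification (the dropped terms have zero coefficient)
  have hmain := hφ.hasSum_mul_of_hasSummableGerms hρ0 hG (crossF s σ g) hS
  refine hmain.congr_fun fun q => ?_
  by_cases hq : q.2 ≤ ℓ + q.1
  · simp only [hF, if_pos hq, hc]
  · simp only [hc]
    rw [show hrCoeff Δ ℓ q.1 q.2 = 0 from hrCoeff_eq_zero_of_lt Δ (by omega)]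
    simp

end Summit.CriticalPhenomena.Ising3D
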